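import Literature.MathematicalPhysics.QuantumLattice.DWaveSourceProofs
import Literature.MathematicalPhysics.QuantumLattice.LiebFluxPhaseProofs
import Literature.MathematicalPhysics.QuantumLattice.SectorSpectrum
import Literature.MathematicalPhysics.QuantumLattice.FermionOperatorsProofs
import Literature.MathematicalPhysics.QuantumLattice.HubbardCommutatorBound
import Literature.MathematicalPhysics.QuantumLattice.HubbardModelThermodynamicLimitProofs
import Literature.MathematicalPhysics.QuantumLattice.PairCorrelationsODLROSupRayleighProofs

/-!
# Crux `TwSeededEnsembleEquivalence` (stmt-HubbardSuperconductivity-1698), line `exposed-density-duality` — stub `stub_oneParticleCost`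

T = 0 one-particle cost (entropy-free Lipschitz bound of the sector ground energies in `N`): given the seed commutator bound with constant `C`, `E_{N−1} ≤ E_N + (18(2+|U|)+gC)·2L²/N` and `E_{N+1} ≤ E_N + (18(2+|U|)+gC)·2L²/(2L²−N)` for the seeded canonical Hamiltonian (average `⟨c_kψ, H c_kψ⟩` over the `2L²` orbitals with weights `‖c_kψ‖²`, total `N`; `Σ_k ‖[H, c_k]‖ ≤ 2L²(18(2+|U|) + gC)` from `norm_commutator_hubbardTorusWith_annihilation_le` at μ = 0 and the hypothesis).

Proof (folklore averaging argument, no entropy and no Hermiticity of `H` needed). For a unit `N`-particle `ψ` and a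
family of one-body operators `a_k` (`c_k` for removal, `c†_k` for addition) with `Σ_k a_kᴴ a_k = D` acting as the scalar
`m` on `N`-particle bras (`D = N̂`, `m = N`, resp. `D = |ι| − N̂`, `m = 2L² − N` by the CAR), each `a_k ψ` lies in the
neighbouring sector, so `E' ‖a_k ψ‖² ≤ re ⟨a_k ψ, H a_k ψ⟩` (scaled variational principle); summing over `k`,
`m E' ≤ Σ_k re ⟨ψ, a_kᴴ H a_k ψ⟩ = re ⟨ψ, D H ψ⟩ + Σ_k re ⟨ψ, a_kᴴ [H, a_k] ψ⟩ ≤ m re ⟨ψ, H ψ⟩ + 2L² K` with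
`K = 18(2+|U|) + gC ≥ ‖[H, a_k]‖` (`norm_commutator_hubbardTorusWith_{annihilation,creation}_le` at `μ = 0` for the Hubbard
part, the hypothesis for the seed `(g/L²) ΔᴴΔ`, `‖a_kᴴ‖ ≤ 1`, `re ⟨ψ, X ψ⟩ ≤ ‖X‖`); then the infimum over `ψ`
(`le_csInf`, the sector `N ≤ 2L²` being nonempty) and division by `m > 0`.
-/

namespace Summit.HubbardSuperconductivity.HubbardSuperconductivity.Theorems.TwSeededEnsembleEquivalence.ExposedDensity

open Matrix Filter Topology Literature.MathematicalPhysics.QuantumLattice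
open scoped ComplexOrder Matrix.Norms.L2Operator

noncomputable section

/-! ### One-particle averaging toolkit (sector ground energies of the Fock space over `ι`) -/

section OneParticleWalk

variable {ι : Type*} [LinearOrder ι] [Fintype ι]

omit [LinearOrder ι] in
/-- `⟨A ψ, w⟩ = ⟨ψ, Aᴴ w⟩` for the `star _ ⬝ᵥ _` pairing. [folklore] -/
private theorem star_mulVec_dotProduct (A : Matrix (Finset ι) (Finset ι) ℂ) (ψ w : Fock ι) :
    star (A *ᵥ ψ) ⬝ᵥ w = star ψ ⬝ᵥ (Aᴴ *ᵥ w) := by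
  rw [dotProduct_mulVec, star_mulVec]

/-- Unit-vector Rayleigh quotients are bounded by the `ℓ²`-operator norm: `re ⟨ψ, X ψ⟩ ≤ ‖X‖`.
Reed–Simon I §VI.1. [folklore] -/
private theorem re_dotProduct_mulVec_le_norm (X : Matrix (Finset ι) (Finset ι) ℂ) {ψ : Fock ι}
    (hψ : star ψ ⬝ᵥ ψ = 1) : (star ψ ⬝ᵥ (X *ᵥ ψ)).re ≤ ‖X‖ := by
  rw [Matrix.cstar_norm_def]
  exact re_star_dotProduct_mulVec_le_opNorm X hψ

/-- On an `N`-particle bra the number operator acts as the scalar `N`: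
`⟨ψ, N̂ v⟩ = N ⟨ψ, v⟩` (`N̂` is diagonal with entry `#s` on `|s⟩`). Tasaki (2020) §9.2. [folklore] -/
private theorem star_dotProduct_totalNumberOp_mulVec {N : ℕ} {ψ : Fock ι} (hψ : IsNParticle N ψ)
    (v : Fock ι) :
    star ψ ⬝ᵥ (totalNumberOp *ᵥ v) = (N : ℂ) * (star ψ ⬝ᵥ v) := by
  simp only [dotProduct, Pi.star_apply, totalNumberOp_eq_diagonal, mulVec_diagonal, Finset.mul_sum]
  refine Finset.sum_congr rfl fun s _ => ?_
  by_cases hs : s.card = N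
  · rw [hs]; ring
  · rw [hψ s hs, star_zero, zero_mul, zero_mul, mul_zero]

/-- Scaled variational principle in a sector: `E₀(N) · ‖φ‖² ≤ re ⟨φ, H φ⟩` for every (not
necessarily normalised) `N`-particle vector `φ`. [folklore] -/
private theorem groundEnergy_mul_le_re (H : Matrix (Finset ι) (Finset ι) ℂ) {N : ℕ} {φ : Fock ι}
    (hφ : IsNParticle N φ) :
    groundEnergy H N * (star φ ⬝ᵥ φ).re ≤ (star φ ⬝ᵥ (H *ᵥ φ)).re := by
  by_cases h0 : φ = 0
  · simp [h0]
  obtain ⟨c, -, hunit⟩ := exists_smul_unit h0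
  have hN' : IsNParticle N (c • φ) := fun s hs => by simp [hφ s hs]
  have hle := ThermodynamicLimit.groundEnergy_le_re_expect H hN' hunit
  have hcc : star c * c = ((‖c‖ ^ 2 : ℝ) : ℂ) := by
    rw [Complex.star_def, Complex.conj_mul']
    push_cast
    rfl
  rw [star_smul, smul_dotProduct, dotProduct_smul, smul_smul, hcc, smul_eq_mul] at hunit
  have hunit' : ‖c‖ ^ 2 * (star φ ⬝ᵥ φ).re = 1 := by
    have := congrArg Complex.re hunit
    rwa [Complex.re_ofReal_mul, Complex.one_re] at this
  have hexp : (expect H (c • φ)).re = ‖c‖ ^ 2 * (star φ ⬝ᵥ (H *ᵥ φ)).re := by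
    rw [expect, mulVec_smul, star_smul, smul_dotProduct, dotProduct_smul, smul_smul, hcc, smul_eq_mul,
      Complex.re_ofReal_mul]
  rw [hexp] at hle
  have hq : 0 ≤ (star φ ⬝ᵥ φ).re := by
    have := dotProduct_star_self_nonneg φ
    exact (Complex.nonneg_iff.mp this).1
  calc groundEnergy H N * (star φ ⬝ᵥ φ).re
      ≤ ‖c‖ ^ 2 * (star φ ⬝ᵥ (H *ᵥ φ)).re * (star φ ⬝ᵥ φ).re :=
        mul_le_mul_of_nonneg_right hle hq
    _ = (‖c‖ ^ 2 * (star φ ⬝ᵥ φ).re) * (star φ ⬝ᵥ (H *ᵥ φ)).re := by ring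
    _ = (star φ ⬝ᵥ (H *ᵥ φ)).re := by rw [hunit', one_mul]

/-- **One-particle averaging step.** If `Σ_k a_kᴴ a_k = D` acts as the scalar `m > 0` against
`N`-particle bras, every `a_k` maps the `N`-particle sector into the `N'`-particle sector,
`‖a_kᴴ‖ ≤ 1` and `‖[H, a_k]‖ ≤ K` for all `k`, then `E₀(N') ≤ E₀(N) + K |ι| / m`: average the
Rayleigh quotients of the trial vectors `a_k ψ` with weights `‖a_k ψ‖²` (total `m`), commute `H`
past `a_k` at cost `K` per orbital, and take the infimum over unit `N`-particle `ψ`. [folklore] -/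
private theorem groundEnergy_step_le (H : Matrix (Finset ι) (Finset ι) ℂ)
    (a : ι → Matrix (Finset ι) (Finset ι) ℂ) (D : Matrix (Finset ι) (Finset ι) ℂ)
    (hsum : ∑ k, (a k)ᴴ * a k = D) {N N' : ℕ} {m K : ℝ}
    (hmap : ∀ ψ : Fock ι, IsNParticle N ψ → ∀ k, IsNParticle N' (a k *ᵥ ψ))
    (hD : ∀ ψ : Fock ι, IsNParticle N ψ → ∀ v : Fock ι,
      star ψ ⬝ᵥ (D *ᵥ v) = (m : ℂ) * (star ψ ⬝ᵥ v))
    (hnorm : ∀ k, ‖(a k)ᴴ‖ ≤ 1) (hK : ∀ k, ‖H * a k - a k * H‖ ≤ K)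
    (hm : 0 < m) (hN : N ≤ Fintype.card ι) :
    groundEnergy H N' ≤ groundEnergy H N + K * Fintype.card ι / m := by
  have key : ∀ ψ : Fock ι, IsNParticle N ψ → star ψ ⬝ᵥ ψ = 1 →
      m * groundEnergy H N' ≤ m * (star ψ ⬝ᵥ (H *ᵥ ψ)).re + K * Fintype.card ι := by
    intro ψ hψN hψ1
    have h1 : ∀ k, groundEnergy H N' * (star (a k *ᵥ ψ) ⬝ᵥ (a k *ᵥ ψ)).re ≤
        (star (a k *ᵥ ψ) ⬝ᵥ (H *ᵥ (a k *ᵥ ψ))).re :=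
      fun k => groundEnergy_mul_le_re H (hmap ψ hψN k)
    have h2 : ∑ k, (star (a k *ᵥ ψ) ⬝ᵥ (a k *ᵥ ψ)).re = m := by
      have h : ∑ k, star (a k *ᵥ ψ) ⬝ᵥ (a k *ᵥ ψ) = (m : ℂ) := by
        simp_rw [star_mulVec_dotProduct, mulVec_mulVec]
        rw [← dotProduct_sum, ← sum_mulVec, hsum, hD ψ hψN, hψ1, mul_one]
      rw [← Complex.re_sum, h, Complex.ofReal_re]
    have h3 : ∑ k, star (a k *ᵥ ψ) ⬝ᵥ (H *ᵥ (a k *ᵥ ψ)) =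
        (m : ℂ) * (star ψ ⬝ᵥ (H *ᵥ ψ)) +
          ∑ k, star ψ ⬝ᵥ (((a k)ᴴ * (H * a k - a k * H)) *ᵥ ψ) := by
      have hk : ∀ k, star (a k *ᵥ ψ) ⬝ᵥ (H *ᵥ (a k *ᵥ ψ)) =
          star ψ ⬝ᵥ (((a k)ᴴ * a k) *ᵥ (H *ᵥ ψ)) +
            star ψ ⬝ᵥ (((a k)ᴴ * (H * a k - a k * H)) *ᵥ ψ) := by
        intro k
        rw [star_mulVec_dotProduct, ← dotProduct_add]
        congr 1
        simp only [← mulVec_mulVec, sub_mulVec, mulVec_sub]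
        abel
      rw [Finset.sum_congr rfl fun k _ => hk k, Finset.sum_add_distrib, ← dotProduct_sum,
        ← sum_mulVec, hsum, hD ψ hψN]
    have h4 : ∀ k, (star ψ ⬝ᵥ (((a k)ᴴ * (H * a k - a k * H)) *ᵥ ψ)).re ≤ K := fun k =>
      calc (star ψ ⬝ᵥ (((a k)ᴴ * (H * a k - a k * H)) *ᵥ ψ)).re
          ≤ ‖(a k)ᴴ * (H * a k - a k * H)‖ := re_dotProduct_mulVec_le_norm _ hψ1
        _ ≤ ‖(a k)ᴴ‖ * ‖H * a k - a k * H‖ := norm_mul_le _ _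
        _ ≤ 1 * K := mul_le_mul (hnorm k) (hK k) (norm_nonneg _) zero_le_one
        _ = K := one_mul K
    calc m * groundEnergy H N'
        = groundEnergy H N' * ∑ k, (star (a k *ᵥ ψ) ⬝ᵥ (a k *ᵥ ψ)).re := by rw [h2, mul_comm]
      _ = ∑ k, groundEnergy H N' * (star (a k *ᵥ ψ) ⬝ᵥ (a k *ᵥ ψ)).re := by rw [Finset.mul_sum]
      _ ≤ ∑ k, (star (a k *ᵥ ψ) ⬝ᵥ (H *ᵥ (a k *ᵥ ψ))).re := Finset.sum_le_sum fun k _ => h1 k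
      _ = (∑ k, star (a k *ᵥ ψ) ⬝ᵥ (H *ᵥ (a k *ᵥ ψ))).re := (Complex.re_sum _ _).symm
      _ = m * (star ψ ⬝ᵥ (H *ᵥ ψ)).re +
            ∑ k, (star ψ ⬝ᵥ (((a k)ᴴ * (H * a k - a k * H)) *ᵥ ψ)).re := by
          rw [h3, Complex.add_re, Complex.re_ofReal_mul, Complex.re_sum]
      _ ≤ m * (star ψ ⬝ᵥ (H *ᵥ ψ)).re + ∑ _k : ι, K := by
          gcongr with k _
          exact h4 k
      _ = m * (star ψ ⬝ᵥ (H *ᵥ ψ)).re + K * Fintype.card ι := by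
          rw [Finset.sum_const, Finset.card_univ, nsmul_eq_mul, mul_comm (K : ℝ)]
  -- infimum over unit `N`-particle vectors
  have hne := ThermodynamicLimit.groundEnergySet_nonempty H hN
  rw [← sub_le_iff_le_add]
  refine le_csInf hne ?_
  rintro E ⟨ψ, hψN, hψ1, rfl⟩
  have hk := key ψ hψN hψ1
  have h : groundEnergy H N' - (expect H ψ).re ≤ K * Fintype.card ι / m := by
    rw [le_div_iff₀ hm, expect]
    linarith
  linarith

/-- **Removal step**: `E₀(N−1) ≤ E₀(N) + K |ι| / N` for `1 ≤ N ≤ |ι|`, if `‖[H, c_k]‖ ≤ K` for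
every orbital `k` (weights `‖c_k ψ‖²` summing to `⟨ψ, N̂ ψ⟩ = N`). [folklore] -/
private theorem groundEnergy_pred_le (H : Matrix (Finset ι) (Finset ι) ℂ) {K : ℝ}
    (hK : ∀ k, ‖H * annihilation k - annihilation k * H‖ ≤ K) {N : ℕ} (hN1 : 1 ≤ N)
    (hN : N ≤ Fintype.card ι) :
    groundEnergy H (N - 1) ≤ groundEnergy H N + K * Fintype.card ι / N := by
  refine groundEnergy_step_le H annihilation totalNumberOp rfl (m := (N : ℝ)) ?_ ?_ ?_ hK
    (by exact_mod_cast hN1) hN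
  · intro ψ hψ k
    have h' : IsNParticle (N - 1 + 1) ψ := by rwa [Nat.sub_add_cancel hN1]
    exact IsNParticle.annihilation_mulVec_holds h' k
  · intro ψ hψ v
    rw [Complex.ofReal_natCast]
    exact star_dotProduct_totalNumberOp_mulVec hψ v
  · intro k
    rw [annihilation_conjTranspose]
    exact norm_creation_le_one k

/-- **Addition step**: `E₀(N+1) ≤ E₀(N) + K |ι| / (|ι| − N)` for `N + 1 ≤ |ι|`, if
`‖[H, c†_k]‖ ≤ K` for every orbital `k` (weights `‖c†_k ψ‖²` summing to `⟨ψ, (|ι| − N̂) ψ⟩ = |ι| − N`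
by the CAR). [folklore] -/
private theorem groundEnergy_succ_le (H : Matrix (Finset ι) (Finset ι) ℂ) {K : ℝ}
    (hK : ∀ k, ‖H * creation k - creation k * H‖ ≤ K) {N : ℕ} (hN : N + 1 ≤ Fintype.card ι) :
    groundEnergy H (N + 1) ≤ groundEnergy H N + K * Fintype.card ι / ((Fintype.card ι : ℝ) - N) := by
  have hm : (0 : ℝ) < (Fintype.card ι : ℝ) - N := by
    have : (N : ℝ) + 1 ≤ Fintype.card ι := by exact_mod_cast hN
    linarith
  refine groundEnergy_step_le H creation ((Fintype.card ι : ℂ) • 1 - totalNumberOp) ?_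
    (m := (Fintype.card ι : ℝ) - N) (fun ψ hψ k => IsNParticle.creation_mulVec_holds hψ k) ?_ ?_ hK
    hm (by omega)
  · have hCAR := annihilation_mul_creation_add_creation_mul_annihilation_holds (ι := ι)
    have h1 : ∀ k : ι, (creation k)ᴴ * creation k = 1 - numberAt k := fun k => by
      rw [creation_conjTranspose, numberAt, eq_sub_iff_add_eq]
      have h := hCAR k k
      rwa [if_pos rfl] at h
    simp only [h1, Finset.sum_sub_distrib, Finset.sum_const, Finset.card_univ, totalNumberOp]
    rw [← Nat.cast_smul_eq_nsmul ℂ]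
  · intro ψ hψ v
    rw [sub_mulVec, smul_mulVec, one_mulVec, dotProduct_sub, dotProduct_smul, smul_eq_mul,
      star_dotProduct_totalNumberOp_mulVec hψ v]
    push_cast
    ring
  · intro k
    rw [creation_conjTranspose]
    exact norm_annihilation_le_one k

end OneParticleWalk

/-! ### The registered stub -/

/-- T = 0 one-particle cost (entropy-free Lipschitz bound of the sector ground energies in `N`): given the seed commutator bound with constant `C`, `E_{N−1} ≤ E_N + (18(2+|U|)+gC)·2L²/N` and `E_{N+1} ≤ E_N + (18(2+|U|)+gC)·2L²/(2L²−N)` for the seeded canonical Hamiltonian (average `⟨c_kψ, H c_kψ⟩` over the `2L²` orbitals with weights `‖c_kψ‖²`, total `N`; `Σ_k ‖[H, c_k]‖ ≤ 2L²(18(2+|U|) + gC)` from `norm_commutator_hubbardTorusWith_annihilation_le` at μ = 0 and the hypothesis). -/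
theorem stub_oneParticleCost :
    ∀ C : ℝ, 0 ≤ C →
      (∀ (L : ℕ) [NeZero L] (k : Orb (FermionTorus 2 L)),
        ‖(pairField dWaveFormFactor L)ᴴ * pairField dWaveFormFactor L * annihilation k -
            annihilation k * ((pairField dWaveFormFactor L)ᴴ * pairField dWaveFormFactor L)‖ ≤
          C * (L : ℝ) ^ 2 ∧
        ‖(pairField dWaveFormFactor L)ᴴ * pairField dWaveFormFactor L * creation k -
            creation k * ((pairField dWaveFormFactor L)ᴴ * pairField dWaveFormFactor L)‖ ≤
          C * (L : ℝ) ^ 2) →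
      ∀ (L : ℕ) [NeZero L] (U g : ℝ), 0 ≤ g → ∀ N : ℕ,
        (1 ≤ N → N ≤ 2 * L ^ 2 →
          (hubbardTorus 2 L 1 U - ((g / (L : ℝ) ^ 2 : ℝ) : ℂ) •
            ((pairField dWaveFormFactor L)ᴴ * pairField dWaveFormFactor L)).minEnergyOn
              (nParticleSubmodule (N - 1)) ≤
          (hubbardTorus 2 L 1 U - ((g / (L : ℝ) ^ 2 : ℝ) : ℂ) •
            ((pairField dWaveFormFactor L)ᴴ * pairField dWaveFormFactor L)).minEnergyOn
              (nParticleSubmodule N) +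
            (18 * (2 + |U|) + g * C) * (2 * (L : ℝ) ^ 2) / N) ∧
        (N + 1 ≤ 2 * L ^ 2 →
          (hubbardTorus 2 L 1 U - ((g / (L : ℝ) ^ 2 : ℝ) : ℂ) •
            ((pairField dWaveFormFactor L)ᴴ * pairField dWaveFormFactor L)).minEnergyOn
              (nParticleSubmodule (N + 1)) ≤
          (hubbardTorus 2 L 1 U - ((g / (L : ℝ) ^ 2 : ℝ) : ℂ) •
            ((pairField dWaveFormFactor L)ᴴ * pairField dWaveFormFactor L)).minEnergyOn
              (nParticleSubmodule N) +
            (18 * (2 + |U|) + g * C) * (2 * (L : ℝ) ^ 2) / (2 * (L : ℝ) ^ 2 - N)) := by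
  intro C _hC hPC L _ U g hg N
  set P : Matrix (Finset (Orb (FermionTorus 2 L))) (Finset (Orb (FermionTorus 2 L))) ℂ :=
    (pairField dWaveFormFactor L)ᴴ * pairField dWaveFormFactor L with hP
  set Hs := hubbardTorus 2 L 1 U - ((g / (L : ℝ) ^ 2 : ℝ) : ℂ) • P with hHs
  have hL : (0 : ℝ) < (L : ℝ) ^ 2 := by
    have := NeZero.pos L
    positivity
  have hs : 0 ≤ g / (L : ℝ) ^ 2 := div_nonneg hg hL.le
  have hL0 : (L : ℝ) ≠ 0 := by exact_mod_cast (NeZero.ne L)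
  have hcardN : Fintype.card (Orb (FermionTorus 2 L)) = 2 * L ^ 2 := by
    rw [card_orb]
    simp [FermionTorus, Fintype.card_lex]
  have hcardR : (Fintype.card (Orb (FermionTorus 2 L)) : ℝ) = 2 * (L : ℝ) ^ 2 := by
    rw [hcardN]; push_cast; ring
  -- splitting of the commutator of the seeded Hamiltonian
  have hsplit : ∀ c : Matrix (Finset (Orb (FermionTorus 2 L))) (Finset (Orb (FermionTorus 2 L))) ℂ,
      Hs * c - c * Hs = (hubbardTorus 2 L 1 U * c - c * hubbardTorus 2 L 1 U) -
        ((g / (L : ℝ) ^ 2 : ℝ) : ℂ) • (P * c - c * P) := fun c => by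
    simp only [hHs, sub_mul, mul_sub, smul_mul_assoc, mul_smul_comm, smul_sub]
    abel
  have hbound : ∀ c : Matrix (Finset (Orb (FermionTorus 2 L))) (Finset (Orb (FermionTorus 2 L))) ℂ,
      ‖hubbardTorus 2 L 1 U * c - c * hubbardTorus 2 L 1 U‖ ≤ 18 * (2 + |U|) →
      ‖P * c - c * P‖ ≤ C * (L : ℝ) ^ 2 →
      ‖Hs * c - c * Hs‖ ≤ 18 * (2 + |U|) + g * C := fun c h1 h2 => by
    rw [hsplit c]
    calc ‖(hubbardTorus 2 L 1 U * c - c * hubbardTorus 2 L 1 U) -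
            ((g / (L : ℝ) ^ 2 : ℝ) : ℂ) • (P * c - c * P)‖
        ≤ ‖hubbardTorus 2 L 1 U * c - c * hubbardTorus 2 L 1 U‖ +
            ‖((g / (L : ℝ) ^ 2 : ℝ) : ℂ) • (P * c - c * P)‖ := norm_sub_le _ _
      _ ≤ 18 * (2 + |U|) + g / (L : ℝ) ^ 2 * (C * (L : ℝ) ^ 2) := by
          rw [norm_smul, Complex.norm_real, Real.norm_of_nonneg hs]
          exact add_le_add h1 (mul_le_mul_of_nonneg_left h2 hs)
      _ = 18 * (2 + |U|) + g * C := by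
          field_simp
  have hKa : ∀ k : Orb (FermionTorus 2 L),
      ‖Hs * annihilation k - annihilation k * Hs‖ ≤ 18 * (2 + |U|) + g * C := fun k => by
    refine hbound _ ?_ (hPC L k).1
    have h := norm_commutator_hubbardTorusWith_annihilation_le U 0 L (ofLex k).1 (ofLex k).2
    simp only [hubbardTorusWith_zero, abs_zero, mul_zero, add_zero] at h
    exact h
  have hKc : ∀ k : Orb (FermionTorus 2 L),
      ‖Hs * creation k - creation k * Hs‖ ≤ 18 * (2 + |U|) + g * C := fun k => by
    refine hbound _ ?_ (hPC L k).2
    have h := norm_commutator_hubbardTorusWith_creation_le U 0 L (ofLex k).1 (ofLex k).2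
    simp only [hubbardTorusWith_zero, abs_zero, mul_zero, add_zero] at h
    exact h
  have hbridge : ∀ M : ℕ, Hs.minEnergyOn (nParticleSubmodule M) = groundEnergy Hs M := fun M =>
    (groundEnergy_eq_minEnergyOn Hs M (nParticleSubmodule M)
      (fun ψ => mem_nParticleSubmodule_iff M ψ)).symm
  refine ⟨fun hN1 hN => ?_, fun hN => ?_⟩
  · rw [hbridge, hbridge]
    have h := groundEnergy_pred_le Hs hKa hN1 (by rw [hcardN]; exact hN)
    rwa [hcardR] at h
  · rw [hbridge, hbridge]
    have h := groundEnergy_succ_le Hs hKc (N := N) (by rw [hcardN]; exact hN)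
    rwa [hcardR] at h


end

end Summit.HubbardSuperconductivity.HubbardSuperconductivity.Theorems.TwSeededEnsembleEquivalence.ExposedDensity
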